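import Summits.RiemannHypothesis.RiemannHypothesis.Theorems.MotivicDoorAWSWindowBounds
import Mathlib.Topology.ContinuousMap.Weierstrass
import Mathlib.Analysis.Calculus.Deriv.Polynomial
import Mathlib.Analysis.Calculus.Deriv.Support
import Mathlib.MeasureTheory.Integral.IntervalIntegral.FundThmCalculus

/-!
# AWS sprint, GENERATORS-UP (part 1): `C¹`-approximation by rational polynomials on a window

HONEST LABEL (verbatim on every AWS file).  One-way implication from a strengthened,
prime-side-only axiom system; the existence of such an object is NOT claimed and is the located
gap; the converse (RH ⇒ existence) is out of scope and, for this axiom system, tautological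
rather than informative (AXIOM-CONTENT.md §2; `riemannHypothesis_iff_exists_tautologicalCarrier`).
Framing: lottery ticket at the motivic door; RH probability
negligible; consolation prizes are real: a new semi-local Weil-positivity theorem, or a located gap
in the Connes–Consani programme, plus the ff-door theorem.

## Content

Elementary real analysis used by the density theorem of the monomial–bump generating family
(`Theorems/MotivicDoor/AWS/ForcingUp`), all PROVED, no new definitions:

* a real smooth compactly supported function complexifies to a Weil test (`isWeilTest_ofReal`;
  the converse bridges are `contDiff_of_isWeilTest`, `hasCompactSupport_of_isWeilTest` of
  `Theorems/MotivicDoorAWSWindowBounds`); a compactly supported function lives in a window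
  `[-n, n]` (`exists_nat_tsupport_subset`);
* additivity of the integer combinations `u_c = Σ c_i φ_i` (`testCombination`) in the
  coefficient vector (`testCombination_add`, `testCombination_finset_sum`,
  `testCombination_single`, `testCombination_single_apply`);
* `exists_polynomial_C1_near` — `C¹`-WEIERSTRASS ON A WINDOW: a differentiable `u` with continuous
  derivative and `u(-R) = 0` is `C¹`-uniformly close on `[-R, R]` to a polynomial (Weierstrass,
  Mathlib `exists_polynomial_near_of_continuousOn`, applied to `u'`; polynomial antiderivative
  `exists_derivative_eq`; fundamental theorem of calculus
  `intervalIntegral.integral_eq_sub_of_hasDerivAt`);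
* `exists_int_polynomial_near` — RATIONALISATION: a real polynomial is `C¹`-close on `[-R, R]`
  to `N⁻¹ P` with `P ∈ ℤ[X]`, `N ≥ 1` (coefficientwise `⌊a N⌋ / N`, by induction on the polynomial);
* `exists_int_polynomial_C1_near` — the two combined.

No zeros of `ζ`, no `RiemannHypothesis`, no Weil functional: pure real analysis.
-/

noncomputable section

open Complex Set MeasureTheory Filter Polynomial Metric Literature.NumberTheory.LFunctions
open scoped Topology ContDiff Interval

namespace Summit.RiemannHypothesis.RiemannHypothesis.Theorems.MotivicDoor.AWS

/-! ## Real test functions given through their complexification -/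

namespace ForcingUp

/-- A real smooth compactly supported function complexifies to a Weil test function (converse
of `contDiff_of_isWeilTest`, `hasCompactSupport_of_isWeilTest` of
`Theorems/MotivicDoorAWSWindowBounds`). -/
theorem isWeilTest_ofReal {u : ℝ → ℝ} (hs : ContDiff ℝ ∞ u) (hc : HasCompactSupport u) :
    IsWeilTest fun t ↦ (u t : ℂ) :=
  ⟨ofRealCLM.contDiff.comp hs, hc.comp_left Complex.ofReal_zero⟩

/-- A compactly supported real function is supported in a window `[-n, n]`, `n ∈ ℕ`. -/
theorem exists_nat_tsupport_subset {u : ℝ → ℝ} (hu : HasCompactSupport u) :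
    ∃ n : ℕ, tsupport u ⊆ Icc (-(n : ℝ)) n := by
  obtain ⟨r, hr⟩ := hu.isCompact.isBounded.subset_closedBall (0 : ℝ)
  refine ⟨⌈r⌉₊, hr.trans fun t ht ↦ ?_⟩
  rw [mem_closedBall_zero_iff, Real.norm_eq_abs] at ht
  have h := abs_le.mp (ht.trans (Nat.le_ceil r))
  exact ⟨h.1, h.2⟩

/-- The integer combination attached to a single generator with coefficient `1` is that
generator. -/
theorem testCombination_single {ι : Type*} (φ : ι → ℝ → ℝ) (i : ι) :
    testCombination φ (Finsupp.single i 1) = φ i := by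
  funext t
  simp [testCombination, Finsupp.sum_single_index]

end ForcingUp

/-! ## Integer combinations: additivity of `testCombination` -/

namespace ForcingUp

/-- `u_{c₁ + c₂} = u_{c₁} + u_{c₂}`. -/
theorem testCombination_add {ι : Type*} (φ : ι → ℝ → ℝ) (c₁ c₂ : ι →₀ ℤ) :
    testCombination φ (c₁ + c₂) = testCombination φ c₁ + testCombination φ c₂ := by
  funext t
  simp only [testCombination, Pi.add_apply]
  exact Finsupp.sum_add_index' (fun i ↦ by simp) (fun i b₁ b₂ ↦ by push_cast; ring)

/-- `testCombination` of a finite sum of coefficient vectors. -/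
theorem testCombination_finset_sum {ι κ : Type*} (φ : ι → ℝ → ℝ) (s : Finset κ)
    (g : κ → ι →₀ ℤ) :
    testCombination φ (∑ k ∈ s, g k) = ∑ k ∈ s, testCombination φ (g k) := by
  classical
  induction s using Finset.induction_on with
  | empty => funext t; simp [testCombination]
  | insert k s hk ih => rw [Finset.sum_insert hk, Finset.sum_insert hk, testCombination_add, ih]

/-- `u_{m • δ_i} = m φ_i`. -/
theorem testCombination_single_apply {ι : Type*} (φ : ι → ℝ → ℝ) (i : ι) (m : ℤ) (t : ℝ) :
    testCombination φ (Finsupp.single i m) t = (m : ℝ) * φ i t := by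
  simp [testCombination, Finsupp.sum_single_index]

end ForcingUp

/-! ## Polynomial `C¹`-approximation with rational coefficients on a window -/

namespace ForcingUp

/-- Every real polynomial has a polynomial antiderivative
(`Σ a_k X^k ↦ Σ a_k X^{k+1} / (k+1)`). -/
theorem exists_derivative_eq (q : ℝ[X]) : ∃ p : ℝ[X], derivative p = q := by
  refine ⟨q.sum fun k a ↦ monomial (k + 1) (a / (k + 1)), ?_⟩
  conv_rhs => rw [← sum_monomial_eq q]
  simp only [Polynomial.sum_def, derivative_sum, derivative_monomial_succ]
  refine Finset.sum_congr rfl fun k _ ↦ ?_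
  rw [div_mul_cancel₀ _ (Nat.cast_add_one_ne_zero k)]

/-- **`C¹`-Weierstrass on a window.**  A differentiable function with continuous derivative which
vanishes at `-R` is, on `[-R, R]`, `C¹`-uniformly approximated by polynomials: Weierstrass
(`exists_polynomial_near_of_continuousOn`) for `u'`, then a polynomial antiderivative and the
fundamental theorem of calculus. -/
theorem exists_polynomial_C1_near {u : ℝ → ℝ} (hd : Differentiable ℝ u)
    (hc : Continuous (deriv u)) {R : ℝ} (hR : 0 < R) (hu0 : u (-R) = 0) {η : ℝ} (hη : 0 < η) :
    ∃ p : ℝ[X], ∀ t ∈ Icc (-R) R,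
      |p.eval t - u t| ≤ η ∧ |p.derivative.eval t - deriv u t| ≤ η := by
  set η' : ℝ := η / (2 * R + 1) with hη'
  have hη'pos : 0 < η' := by positivity
  have hη'le : η' ≤ η := div_le_self hη.le (by linarith)
  obtain ⟨q, hq⟩ :=
    exists_polynomial_near_of_continuousOn (-R) R (deriv u) hc.continuousOn η' hη'pos
  obtain ⟨p₀, hp₀⟩ := exists_derivative_eq q
  set p : ℝ[X] := p₀ - C (p₀.eval (-R)) with hp
  have hp' : derivative p = q := by simp [hp, hp₀]
  have hpR : p.eval (-R) = 0 := by simp [hp]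
  refine ⟨p, fun t ht ↦ ⟨?_, by rw [hp']; exact (hq t ht).le.trans hη'le⟩⟩
  have hqi : IntervalIntegrable (fun s ↦ q.eval s) volume (-R) t :=
    q.continuous.intervalIntegrable _ _
  have hui : IntervalIntegrable (deriv u) volume (-R) t := hc.intervalIntegrable _ _
  have h1 : ∫ s in (-R)..t, q.eval s = p.eval t - p.eval (-R) := by
    apply intervalIntegral.integral_eq_sub_of_hasDerivAt
    · intro x _
      simpa [hp'] using p.hasDerivAt x
    · exact hqi
  have h2 : ∫ s in (-R)..t, deriv u s = u t - u (-R) := by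
    apply intervalIntegral.integral_eq_sub_of_hasDerivAt
    · intro x _
      exact (hd x).hasDerivAt
    · exact hui
  have h3 : p.eval t - u t = ∫ s in (-R)..t, (q.eval s - deriv u s) := by
    rw [intervalIntegral.integral_sub hqi hui, h1, h2, hpR, hu0]; ring
  have hbound : ∀ s ∈ Ι (-R) t, ‖q.eval s - deriv u s‖ ≤ η' := by
    intro s hs
    rw [Set.uIoc_of_le ht.1] at hs
    rw [Real.norm_eq_abs]
    exact (hq s ⟨hs.1.le, hs.2.trans ht.2⟩).le
  have h4 := intervalIntegral.norm_integral_le_of_norm_le_const hbound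
  rw [Real.norm_eq_abs] at h4
  have habs : |t - -R| ≤ 2 * R := by
    rw [abs_le]; constructor <;> linarith [ht.1, ht.2]
  calc |p.eval t - u t| = |∫ s in (-R)..t, (q.eval s - deriv u s)| := by rw [h3]
    _ ≤ η' * |t - -R| := h4
    _ ≤ η' * (2 * R + 1) := by gcongr; linarith
    _ = η := by rw [hη']; field_simp

/-- **Rationalisation.**  A real polynomial is, on `[-R, R]`, `C¹`-uniformly approximated by
polynomials `N⁻¹ P` with `P ∈ ℤ[X]` and a common denominator `N ≥ 1` (coefficientwise
`⌊a N⌋ / N`). -/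
theorem exists_int_polynomial_near (p : ℝ[X]) {R : ℝ} (hR : 0 ≤ R) :
    ∀ {η : ℝ}, 0 < η → ∃ (N : ℕ) (P : ℤ[X]), 0 < N ∧ ∀ t ∈ Icc (-R) R,
      |p.eval t - (N : ℝ)⁻¹ * (P.map (Int.castRingHom ℝ)).eval t| ≤ η ∧
      |p.derivative.eval t - (N : ℝ)⁻¹ * (derivative (P.map (Int.castRingHom ℝ))).eval t| ≤ η := by
  induction p using Polynomial.induction_on' with
  | add p q hp hq =>
    intro η hη
    obtain ⟨N₁, P₁, hN₁, h₁⟩ := hp (half_pos hη)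
    obtain ⟨N₂, P₂, hN₂, h₂⟩ := hq (half_pos hη)
    refine ⟨N₁ * N₂, (N₂ : ℤ) • P₁ + (N₁ : ℤ) • P₂, Nat.mul_pos hN₁ hN₂, fun t ht ↦ ?_⟩
    obtain ⟨h₁v, h₁d⟩ := h₁ t ht
    obtain ⟨h₂v, h₂d⟩ := h₂ t ht
    have hN₁' : (N₁ : ℝ) ≠ 0 := by exact_mod_cast hN₁.ne'
    have hN₂' : (N₂ : ℝ) ≠ 0 := by exact_mod_cast hN₂.ne'
    have ev : ((N₁ * N₂ : ℕ) : ℝ)⁻¹ *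
          (((N₂ : ℤ) • P₁ + (N₁ : ℤ) • P₂).map (Int.castRingHom ℝ)).eval t =
        (N₁ : ℝ)⁻¹ * (P₁.map (Int.castRingHom ℝ)).eval t +
          (N₂ : ℝ)⁻¹ * (P₂.map (Int.castRingHom ℝ)).eval t := by
      simp only [Polynomial.map_add, Polynomial.map_smul, eval_add, eval_smul, map_natCast,
        smul_eq_mul, Nat.cast_mul]
      field_simp
    have ed : ((N₁ * N₂ : ℕ) : ℝ)⁻¹ *
          (derivative (((N₂ : ℤ) • P₁ + (N₁ : ℤ) • P₂).map (Int.castRingHom ℝ))).eval t =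
        (N₁ : ℝ)⁻¹ * (derivative (P₁.map (Int.castRingHom ℝ))).eval t +
          (N₂ : ℝ)⁻¹ * (derivative (P₂.map (Int.castRingHom ℝ))).eval t := by
      simp only [Polynomial.map_add, Polynomial.map_smul, derivative_add, derivative_smul,
        eval_add, eval_smul, map_natCast, smul_eq_mul, Nat.cast_mul]
      field_simp
    rw [ev, ed, eval_add, derivative_add, eval_add]
    constructor
    · calc |p.eval t + q.eval t - ((N₁ : ℝ)⁻¹ * (P₁.map (Int.castRingHom ℝ)).eval t +
              (N₂ : ℝ)⁻¹ * (P₂.map (Int.castRingHom ℝ)).eval t)|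
            = |(p.eval t - (N₁ : ℝ)⁻¹ * (P₁.map (Int.castRingHom ℝ)).eval t) +
                (q.eval t - (N₂ : ℝ)⁻¹ * (P₂.map (Int.castRingHom ℝ)).eval t)| := by ring_nf
        _ ≤ |p.eval t - (N₁ : ℝ)⁻¹ * (P₁.map (Int.castRingHom ℝ)).eval t| +
              |q.eval t - (N₂ : ℝ)⁻¹ * (P₂.map (Int.castRingHom ℝ)).eval t| := abs_add_le _ _
        _ ≤ η / 2 + η / 2 := add_le_add h₁v h₂v
        _ = η := add_halves η
    · calc |p.derivative.eval t + q.derivative.eval t -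
              ((N₁ : ℝ)⁻¹ * (derivative (P₁.map (Int.castRingHom ℝ))).eval t +
                (N₂ : ℝ)⁻¹ * (derivative (P₂.map (Int.castRingHom ℝ))).eval t)|
            = |(p.derivative.eval t - (N₁ : ℝ)⁻¹ * (derivative (P₁.map (Int.castRingHom ℝ))).eval t) +
                (q.derivative.eval t -
                  (N₂ : ℝ)⁻¹ * (derivative (P₂.map (Int.castRingHom ℝ))).eval t)| := by ring_nf
        _ ≤ |p.derivative.eval t - (N₁ : ℝ)⁻¹ * (derivative (P₁.map (Int.castRingHom ℝ))).eval t| +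
              |q.derivative.eval t -
                (N₂ : ℝ)⁻¹ * (derivative (P₂.map (Int.castRingHom ℝ))).eval t| := abs_add_le _ _
        _ ≤ η / 2 + η / 2 := add_le_add h₁d h₂d
        _ = η := add_halves η
  | monomial k a =>
    intro η hη
    set M : ℝ := R ^ k + k * R ^ (k - 1) with hM
    have hM0 : 0 ≤ M := by positivity
    obtain ⟨N, hN⟩ := exists_nat_gt (M / η)
    have hNR : (0 : ℝ) < N := (div_nonneg hM0 hη.le).trans_lt hN
    have hNpos : 0 < N := by exact_mod_cast hNR
    set m : ℤ := ⌊a * N⌋ with hm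
    refine ⟨N, monomial k m, hNpos, fun t ht ↦ ?_⟩
    have habs : |a - (N : ℝ)⁻¹ * m| ≤ (N : ℝ)⁻¹ := by
      have h1 : (m : ℝ) ≤ a * N := Int.floor_le _
      have h2 : a * N < m + 1 := Int.lt_floor_add_one _
      rw [abs_le]
      constructor
      · have : (N : ℝ)⁻¹ * m ≤ a := by rw [inv_mul_le_iff₀ hNR]; linarith
        linarith [inv_pos.mpr hNR]
      · have : a ≤ (N : ℝ)⁻¹ * (m + 1) := by rw [le_inv_mul_iff₀ hNR]; linarith
        linarith
    have ht' : |t| ≤ R := abs_le.mpr ⟨by linarith [ht.1], ht.2⟩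
    have hMN : (N : ℝ)⁻¹ * M ≤ η := by
      rw [inv_mul_le_iff₀ hNR]
      have := (div_lt_iff₀ hη).mp hN
      linarith
    have hRk : R ^ k ≤ M := by
      have : 0 ≤ (k : ℝ) * R ^ (k - 1) := by positivity
      linarith
    have hkR : (k : ℝ) * R ^ (k - 1) ≤ M := by
      have : 0 ≤ R ^ k := by positivity
      linarith
    simp only [Polynomial.map_monomial, eval_monomial, derivative_monomial, eq_intCast]
    constructor
    · have e1 : a * t ^ k - (N : ℝ)⁻¹ * ((m : ℝ) * t ^ k) = (a - (N : ℝ)⁻¹ * m) * t ^ k := by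
        ring
      rw [e1, abs_mul, abs_pow]
      calc |a - (N : ℝ)⁻¹ * m| * |t| ^ k ≤ (N : ℝ)⁻¹ * R ^ k := by gcongr
        _ ≤ (N : ℝ)⁻¹ * M := by gcongr
        _ ≤ η := hMN
    · have e2 : a * (k : ℝ) * t ^ (k - 1) - (N : ℝ)⁻¹ * ((m : ℝ) * k * t ^ (k - 1)) =
          (a - (N : ℝ)⁻¹ * m) * ((k : ℝ) * t ^ (k - 1)) := by ring
      rw [e2, abs_mul, abs_mul, abs_pow, Nat.abs_cast]
      calc |a - (N : ℝ)⁻¹ * m| * ((k : ℝ) * |t| ^ (k - 1)) ≤ (N : ℝ)⁻¹ * ((k : ℝ) * R ^ (k - 1)) := by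
            gcongr
        _ ≤ (N : ℝ)⁻¹ * M := by gcongr
        _ ≤ η := hMN

/-- **`C¹`-approximation by rational polynomials on a window** (the two previous lemmas
combined): `|u - N⁻¹ P| ≤ η` and `|u' - N⁻¹ P'| ≤ η` on `[-R, R]` with `P ∈ ℤ[X]`, `N ≥ 1`. -/
theorem exists_int_polynomial_C1_near {u : ℝ → ℝ} (hd : Differentiable ℝ u)
    (hc : Continuous (deriv u)) {R : ℝ} (hR : 0 < R) (hu0 : u (-R) = 0) {η : ℝ} (hη : 0 < η) :
    ∃ (N : ℕ) (P : ℤ[X]), 0 < N ∧ ∀ t ∈ Icc (-R) R,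
      |u t - (N : ℝ)⁻¹ * (P.map (Int.castRingHom ℝ)).eval t| ≤ η ∧
      |deriv u t - (N : ℝ)⁻¹ * (derivative (P.map (Int.castRingHom ℝ))).eval t| ≤ η := by
  obtain ⟨p, hp⟩ := exists_polynomial_C1_near hd hc hR hu0 (half_pos hη)
  obtain ⟨N, P, hN, hP⟩ := exists_int_polynomial_near p hR.le (half_pos hη)
  refine ⟨N, P, hN, fun t ht ↦ ?_⟩
  obtain ⟨hpv, hpd⟩ := hp t ht
  obtain ⟨hPv, hPd⟩ := hP t ht
  constructor
  · calc |u t - (N : ℝ)⁻¹ * (P.map (Int.castRingHom ℝ)).eval t|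
          = |(p.eval t - (N : ℝ)⁻¹ * (P.map (Int.castRingHom ℝ)).eval t) - (p.eval t - u t)| := by
            ring_nf
      _ ≤ |p.eval t - (N : ℝ)⁻¹ * (P.map (Int.castRingHom ℝ)).eval t| + |p.eval t - u t| :=
            abs_sub _ _
      _ ≤ η / 2 + η / 2 := add_le_add hPv hpv
      _ = η := add_halves η
  · calc |deriv u t - (N : ℝ)⁻¹ * (derivative (P.map (Int.castRingHom ℝ))).eval t|
          = |(p.derivative.eval t - (N : ℝ)⁻¹ * (derivative (P.map (Int.castRingHom ℝ))).eval t) -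
              (p.derivative.eval t - deriv u t)| := by ring_nf
      _ ≤ |p.derivative.eval t - (N : ℝ)⁻¹ * (derivative (P.map (Int.castRingHom ℝ))).eval t| +
            |p.derivative.eval t - deriv u t| := abs_sub _ _
      _ ≤ η / 2 + η / 2 := add_le_add hPd hpd
      _ = η := add_halves η

end ForcingUp

end Summit.RiemannHypothesis.RiemannHypothesis.Theorems.MotivicDoor.AWS
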